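import Literature.NumberTheory.DiophantineGeometry.PlaneSectionAveragingEstimateProofs
import HarnessLib

/-!
# Cafure–Matera (2006), Theorem 5.2, for hypersurfaces of degree at most `8`

We prove the estimate of `Literature.NumberTheory.DiophantineGeometry.CafureMatera2006_thm52`
("for an absolutely irreducible `𝔽_q`-hypersurface `H ⊂ 𝔸ⁿ` of degree `δ`:
`|#(H ∩ 𝔽_qⁿ) - q^{n-1}| ≤ (δ-1)(δ-2)q^{n-3/2} + 5δ^{13/3} q^{n-2}`") for all `q`, all `n` and all
`δ ≤ 8` (`CafureMatera2006_thm52_of_totalDegree_le_eight`).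

## Proof

The cases `δ = 1` and `q ≤ 5δ^{10/3}` are `CafureMateraProofs`; `n ≤ 1` forces `δ ≤ 1`
(`IsAbsIrreducible.totalDegree_eq_one_fin_one`). In the remaining case (`n = m + 1 ≥ 2`,
`2 ≤ δ ≤ 8`, `q > 5δ^{10/3} > 50`) we follow the printed proof (§5.1, (21)–(22)) in its
parametrised form: the averaging estimate `PlaneSectionAveragingEstimateProofs.mul_abs_sub_le`
(Weil's estimate on the absolutely irreducible sections, trivial bounds on the others, the count of
vanishing sections) combined with the count of the sections that are not absolutely irreducible,
Cafure–Matera's **Cor. 3.2** from Kaltofen's effective Bertini theorem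
(`PlaneSectionBadParameterCountProofs`), gives
`|N - qᵐ| ≤ q^{m-1} ((δ-1)(δ-2)√q + 1 + δ + 4δ³ + (qᵐ/(qᵐ-1)) (δ² + (δ-1)(3δ⁴/2 - 2δ³ + 5δ²/2)))`,
and `1 + δ + 4δ³ + (51/50)(δ² + (δ-1)(3δ⁴/2 - 2δ³ + 5δ²/2)) ≤ 5δ^{13/3}` for `2 ≤ δ ≤ 8`
(`numeric_le_five_mul_rpow`). For `δ ≥ 9` the coarser count of Cor. 3.2 no longer suffices and the
printed proof uses the refined count of Thm. 3.3 / Cor. 3.4 (Prop. 4.1), not yet in the tree; this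
is why the present theorem stops at `δ = 8`.

## References

* A. Cafure, G. Matera, *Improved explicit estimates on the number of solutions of equations over a
  finite field*, Finite Fields Appl. 12 (2006) 155–185, Thm. 5.2, §5.1 (21)–(22), Cor. 3.2.
  [CafureMatera2006]
* E. Kaltofen, J. Comput. System Sci. 50 (1995) 274–295, Thm. 5. [Kaltofen1995]
-/

noncomputable section

open scoped Classical
open MvPolynomial Literature.RingTheory.MvPolynomial

namespace Literature.NumberTheory.DiophantineGeometry

universe u

/-! ### Numerical lemmas -/

/-- `δ⁴ r ≤ δ^{13/3}` when `r³ ≤ δ` (`r, δ ≥ 0`). [folklore] -/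
theorem pow_four_mul_le_rpow {δ r : ℝ} (hδ : 0 ≤ δ) (hr : 0 ≤ r) (h : r ^ 3 ≤ δ) :
    δ ^ 4 * r ≤ δ ^ ((13 : ℝ) / 3) := by
  have h13 : (13 : ℝ) / 3 = (4 : ℕ) + (3 : ℝ)⁻¹ := by norm_num
  have hr3 : r = (r ^ 3) ^ ((3 : ℝ)⁻¹) := by
    rw [show ((3 : ℝ)⁻¹) = ((3 : ℕ) : ℝ)⁻¹ by norm_num, Real.pow_rpow_inv_natCast hr (by norm_num)]
  rcases hδ.eq_or_lt with rfl | hδ0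
  · have hr0 : r ^ 3 = 0 := le_antisymm h (pow_nonneg hr 3)
    have : r = 0 := (pow_eq_zero_iff (n := 3) (by norm_num)).1 hr0
    simp [this]
  rw [h13, Real.rpow_add hδ0, Real.rpow_natCast]
  refine mul_le_mul_of_nonneg_left ?_ (by positivity)
  rw [hr3]
  exact Real.rpow_le_rpow (by positivity) h (by norm_num)

/-- `δ³ r ≤ δ^{10/3}` when `r³ ≤ δ` (`r, δ ≥ 0`). [folklore] -/
theorem pow_three_mul_le_rpow {δ r : ℝ} (hδ : 0 ≤ δ) (hr : 0 ≤ r) (h : r ^ 3 ≤ δ) :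
    δ ^ 3 * r ≤ δ ^ ((10 : ℝ) / 3) := by
  have h10 : (10 : ℝ) / 3 = (3 : ℕ) + (3 : ℝ)⁻¹ := by norm_num
  have hr3 : r = (r ^ 3) ^ ((3 : ℝ)⁻¹) := by
    rw [show ((3 : ℝ)⁻¹) = ((3 : ℕ) : ℝ)⁻¹ by norm_num, Real.pow_rpow_inv_natCast hr (by norm_num)]
  rcases hδ.eq_or_lt with rfl | hδ0
  · have hr0 : r ^ 3 = 0 := le_antisymm h (pow_nonneg hr 3)
    have : r = 0 := (pow_eq_zero_iff (n := 3) (by norm_num)).1 hr0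
    simp [this]
  rw [h10, Real.rpow_add hδ0, Real.rpow_natCast]
  refine mul_le_mul_of_nonneg_left ?_ (by positivity)
  rw [hr3]
  exact Real.rpow_le_rpow (by positivity) h (by norm_num)

/-- **The numerical heart of Thm. 5.2 for `2 ≤ δ ≤ 8` with the count of Cor. 3.2**:
`1 + δ + 4δ³ + (51/50)(δ² + (δ-1)(3δ⁴ + 5δ² - 4δ³)/2) ≤ 5δ^{13/3}`.
[cite: CafureMatera2006, proof of Thm. 5.2, (22)] -/
theorem numeric_le_five_mul_rpow {δ : ℕ} (h2 : 2 ≤ δ) (h8 : δ ≤ 8) :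
    (1 : ℝ) + δ + 4 * (δ : ℝ) ^ 3 +
        51 / 50 * ((δ : ℝ) ^ 2 + ((δ : ℝ) - 1) * ((3 * (δ : ℝ) ^ 4 + 5 * (δ : ℝ) ^ 2 - 4 * (δ : ℝ) ^ 3) / 2)) ≤
      5 * (δ : ℝ) ^ ((13 : ℝ) / 3) := by
  have hδ0 : (0 : ℝ) ≤ δ := Nat.cast_nonneg _
  interval_cases δ
  · have h := pow_four_mul_le_rpow (δ := (2 : ℕ)) (r := 5 / 4) (by norm_num) (by norm_num) (by norm_num)
    push_cast at h ⊢; nlinarith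
  · have h := pow_four_mul_le_rpow (δ := (3 : ℕ)) (r := 5 / 4) (by norm_num) (by norm_num) (by norm_num)
    push_cast at h ⊢; nlinarith
  · have h := pow_four_mul_le_rpow (δ := (4 : ℕ)) (r := 3 / 2) (by norm_num) (by norm_num) (by norm_num)
    push_cast at h ⊢; nlinarith
  · have h := pow_four_mul_le_rpow (δ := (5 : ℕ)) (r := 3 / 2) (by norm_num) (by norm_num) (by norm_num)
    push_cast at h ⊢; nlinarith
  · have h := pow_four_mul_le_rpow (δ := (6 : ℕ)) (r := 3 / 2) (by norm_num) (by norm_num) (by norm_num)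
    push_cast at h ⊢; nlinarith
  · have h := pow_four_mul_le_rpow (δ := (7 : ℕ)) (r := 19 / 10) (by norm_num) (by norm_num) (by norm_num)
    push_cast at h ⊢; nlinarith
  · have h := pow_four_mul_le_rpow (δ := (8 : ℕ)) (r := 2) (by norm_num) (by norm_num) (by norm_num)
    push_cast at h ⊢; nlinarith

/-- `q > 5δ^{10/3}` with `δ ≥ 2` forces `q ≥ 51` (`2^{10/3} > 10`). [folklore] -/
theorem fiftyone_le_of_lt {δ q : ℕ} (h2 : 2 ≤ δ) (hq : 5 * (δ : ℝ) ^ ((10 : ℝ) / 3) < q) :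
    51 ≤ q := by
  have hδ : (2 : ℝ) ≤ δ := by exact_mod_cast h2
  have h := pow_three_mul_le_rpow (δ := (δ : ℝ)) (r := 5 / 4) (by positivity) (by norm_num)
    (by nlinarith)
  have h8 : (8 : ℝ) ≤ (δ : ℝ) ^ 3 := by
    have := pow_le_pow_left₀ (by norm_num : (0 : ℝ) ≤ 2) hδ 3
    norm_num at this
    exact this
  have h50 : (50 : ℝ) < q := by nlinarith
  exact_mod_cast h50

/-! ### Polynomials in one variable -/

/-- **An absolutely irreducible polynomial in one variable is linear.** [folklore] -/
theorem IsAbsIrreducible.totalDegree_eq_one_fin_one {K : Type} [Field K]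
    {f : MvPolynomial (Fin 1) K} (hf : IsAbsIrreducible f) : f.totalDegree = 1 := by
  set Kb := AlgebraicClosure K
  set ι := algebraMap K Kb with hι
  set F := MvPolynomial.map ι f with hF
  have hF : Irreducible F := hf
  -- the identification `K̄[x₀] ≃ K̄[X]`
  set e : MvPolynomial (Fin 1) Kb ≃ₐ[Kb] Polynomial Kb := uniqueAlgEquiv Kb (Fin 1) with he
  have hirr : Irreducible (e F) := (MulEquiv.irreducible_iff e).2 hF
  have hdeg1 : (e F).degree = 1 := IsAlgClosed.degree_eq_one_of_irreducible Kb hirr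
  -- `e F = a X + b`, so `F = a x₀ + b` has total degree `≤ 1`
  have hform : e F = Polynomial.C ((e F).coeff 1) * Polynomial.X + Polynomial.C ((e F).coeff 0) :=
    Polynomial.eq_X_add_C_of_degree_le_one hdeg1.le
  have hsymmX : e.symm Polynomial.X = X 0 := by
    rw [he]
    simp [uniqueAlgEquiv]
  have hsymmC : ∀ a : Kb, e.symm (Polynomial.C a) = C a := fun a ↦ by
    rw [← Polynomial.algebraMap_eq, AlgEquiv.commutes, MvPolynomial.algebraMap_eq]
  have hF' : F = C ((e F).coeff 1) * X 0 + C ((e F).coeff 0) := by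
    have := congrArg e.symm hform
    rw [AlgEquiv.symm_apply_apply, map_add, map_mul, hsymmX, hsymmC, hsymmC] at this
    exact this
  have hle : F.totalDegree ≤ 1 := by
    rw [hF']
    refine (totalDegree_add _ _).trans (max_le ?_ ?_)
    · exact (totalDegree_mul _ _).trans (by rw [totalDegree_C, zero_add]; exact (totalDegree_X (R := Kb) _).le)
    · rw [totalDegree_C]; exact Nat.zero_le _
  have hmap : F.totalDegree = f.totalDegree := totalDegree_map_of_injective f ι.injective
  have hpos : 0 < f.totalDegree := hf.totalDegree_pos
  omega

/-! ### The main estimate for `2 ≤ δ ≤ 8`, `q > 5δ^{10/3}`, `n ≥ 2` -/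

section Main

variable {K : Type} [Field K] [Fintype K] [DecidableEq K]

/-- **Cafure–Matera's estimate (22) with the count of Cor. 3.2, for `2 ≤ δ ≤ 8`.** Let `K = 𝔽_q`,
`f ∈ K[x₀, …, xₘ]` (`m ≥ 1`) absolutely irreducible of total degree `δ` with `2 ≤ δ ≤ 8` and
`q > 5δ^{10/3}`. Then `|N - qᵐ| ≤ (δ-1)(δ-2) q^{m-1} √q + 5δ^{13/3} q^{m-1}`.
[cite: CafureMatera2006, Thm. 5.2, (21)–(22)] -/
theorem abs_rationalPointCount_sub_le_of_le_eight {m : ℕ} (hm : 1 ≤ m)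
    {f : MvPolynomial (Fin (m + 1)) K} (hf : IsAbsIrreducible f) {δ : ℕ} (hδ2 : 2 ≤ δ) (hδ8 : δ ≤ 8)
    (hdeg : f.totalDegree = δ) (hq : 5 * (δ : ℝ) ^ ((10 : ℝ) / 3) < Fintype.card K) :
    |(rationalPointCount f : ℝ) - (Fintype.card K : ℝ) ^ m| ≤
      ((δ - 1) * (δ - 2) : ℕ) * (Fintype.card K : ℝ) ^ (m - 1) * √(Fintype.card K : ℝ) +
        5 * (δ : ℝ) ^ ((13 : ℝ) / 3) * (Fintype.card K : ℝ) ^ (m - 1) := by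
  obtain ⟨k, rfl⟩ : ∃ k, m = k + 1 := ⟨m - 1, by omega⟩
  set q : ℕ := Fintype.card K with hq'
  have hq51 : 51 ≤ q := fiftyone_le_of_lt hδ2 hq
  have hδq : δ < q := by omega
  -- the two estimates
  have hG := mul_abs_sub_le (K := K) (by omega) hf hδ2 hdeg hδq
  have hB := two_mul_card_filter_not_irreducible_planeSection_add_le (K := K) (by omega) f hδ2 hdeg hf
  set B : ℕ := ((Finset.univ : Finset ((Fin (k + 1 + 1) → K) × (Fin (k + 1) → K) × (Fin (k + 1) → K))).filter
    fun p ↦ ¬ Irreducible (MvPolynomial.map (algebraMap K (AlgebraicClosure K))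
      (planeSection f p.1 p.2.1 p.2.2))).card with hBdef
  set D : ℝ := |(rationalPointCount f : ℝ) - (q : ℝ) ^ (k + 1)| with hD
  set W : ℝ := ((δ - 1) * (δ - 2) : ℕ) * √(q : ℝ) + 1 + δ + 4 * (δ : ℝ) ^ 3 with hW
  set κ : ℝ := (3 * (δ : ℝ) ^ 4 + 5 * (δ : ℝ) ^ 2 - 4 * (δ : ℝ) ^ 3) / 2 with hκ
  -- real-number forms
  have hqr : (51 : ℝ) ≤ q := by exact_mod_cast hq51
  have hq0 : (0 : ℝ) < q := by linarith
  have hBr : (B : ℝ) ≤ κ * (q : ℝ) ^ (3 * (k + 1)) := by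
    have : (2 * B + 4 * δ ^ 3 * q ^ (3 * (k + 1)) : ℝ) ≤ (3 * δ ^ 4 + 5 * δ ^ 2) * (q : ℝ) ^ (3 * (k + 1)) := by
      exact_mod_cast hB
    rw [hκ]
    nlinarith
  have hκ0 : 0 ≤ κ := by
    rw [hκ]
    have : (2 : ℝ) ≤ δ := by exact_mod_cast hδ2
    nlinarith [pow_pos (show (0 : ℝ) < δ by linarith) 2, pow_pos (show (0 : ℝ) < δ by linarith) 3]
  have hδ1 : (1 : ℝ) ≤ (δ : ℝ) - 1 := by
    have : (2 : ℝ) ≤ δ := by exact_mod_cast hδ2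
    linarith
  -- rewrite the powers of `q` through `t = q^k` and `u = q^(k+1)`
  have hG' : (q : ℝ) ^ (k + 1 + 2) * ((q : ℝ) ^ (k + 1) - 1) * D ≤
      (q : ℝ) ^ (k + 1) * ((q : ℝ) ^ (k + 1) - 1) * (q : ℝ) ^ (k + 1 + 1) * W +
        (δ : ℝ) ^ 2 * (q : ℝ) ^ (3 * (k + 1) - 1) * (q : ℝ) ^ 2 + ((δ : ℝ) - 1) * q * B := hG
  have h3k : 3 * (k + 1) - 1 = 3 * k + 2 := by omega
  rw [h3k] at hG'
  have h51 : (51 : ℝ) ≤ (q : ℝ) ^ (k + 1) := by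
    calc (51 : ℝ) ≤ q := hqr
      _ = (q : ℝ) ^ 1 := (pow_one _).symm
      _ ≤ (q : ℝ) ^ (k + 1) := pow_le_pow_right₀ (by linarith) (by omega)
  have hu1 : (1 : ℝ) ≤ (q : ℝ) ^ (k + 1) - 1 := by linarith
  -- `Q D ≤ Q q^k W + (δ² + (δ-1) κ) q^k (Q + q^(k+3))` with `Q = q^(k+3) (q^(k+1) - 1)`
  set Q : ℝ := (q : ℝ) ^ (k + 3) * ((q : ℝ) ^ (k + 1) - 1) with hQ
  have hQ0 : 0 < Q := by rw [hQ]; positivity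
  have hkey : Q * D ≤ Q * (q : ℝ) ^ k * W + ((δ : ℝ) ^ 2 + ((δ : ℝ) - 1) * κ) * (q : ℝ) ^ k *
      (Q + (q : ℝ) ^ (k + 3)) := by
    have e1 : (q : ℝ) ^ (k + 1 + 2) * ((q : ℝ) ^ (k + 1) - 1) = Q := by rw [hQ]
    have e2 : (q : ℝ) ^ (k + 1) * ((q : ℝ) ^ (k + 1) - 1) * (q : ℝ) ^ (k + 1 + 1) = Q * (q : ℝ) ^ k := by
      rw [hQ]; ring
    have e3 : (δ : ℝ) ^ 2 * (q : ℝ) ^ (3 * k + 2) * (q : ℝ) ^ 2 =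
        (δ : ℝ) ^ 2 * ((q : ℝ) ^ k * (Q + (q : ℝ) ^ (k + 3))) := by
      rw [hQ]; ring
    have e4 : (q : ℝ) * (q : ℝ) ^ (3 * (k + 1)) = (q : ℝ) ^ k * (Q + (q : ℝ) ^ (k + 3)) := by
      rw [hQ]; ring
    rw [e2, e3] at hG'
    have hB' : ((δ : ℝ) - 1) * q * B ≤ ((δ : ℝ) - 1) * κ * ((q : ℝ) ^ k * (Q + (q : ℝ) ^ (k + 3))) := by
      rw [← e4]
      have := mul_le_mul_of_nonneg_left hBr (show (0 : ℝ) ≤ ((δ : ℝ) - 1) * q by positivity)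
      nlinarith
    nlinarith
  -- divide by `Q` and use `q^(k+3)/Q = 1/(q^(k+1) - 1) ≤ 1/50`
  have hratio : (q : ℝ) ^ (k + 3) ≤ Q / 50 := by
    rw [hQ, le_div_iff₀ (by norm_num : (0 : ℝ) < 50)]
    have : (50 : ℝ) ≤ (q : ℝ) ^ (k + 1) - 1 := by linarith
    nlinarith [pow_pos hq0 (k + 3)]
  have hqk : (0 : ℝ) ≤ (q : ℝ) ^ k := pow_nonneg hq0.le k
  have hD : D ≤ (q : ℝ) ^ k * (W + 51 / 50 * ((δ : ℝ) ^ 2 + ((δ : ℝ) - 1) * κ)) := by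
    have hc : (0 : ℝ) ≤ (δ : ℝ) ^ 2 + ((δ : ℝ) - 1) * κ :=
      add_nonneg (sq_nonneg _) (mul_nonneg (by linarith) hκ0)
    have hc0 : (0 : ℝ) ≤ ((δ : ℝ) ^ 2 + ((δ : ℝ) - 1) * κ) * (q : ℝ) ^ k := mul_nonneg hc hqk
    have h2 : ((δ : ℝ) ^ 2 + ((δ : ℝ) - 1) * κ) * (q : ℝ) ^ k * (Q + (q : ℝ) ^ (k + 3)) ≤
        ((δ : ℝ) ^ 2 + ((δ : ℝ) - 1) * κ) * (q : ℝ) ^ k * (Q + Q / 50) :=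
      mul_le_mul_of_nonneg_left (by linarith [hratio]) hc0
    have h1 : Q * D ≤ Q * ((q : ℝ) ^ k * (W + 51 / 50 * ((δ : ℝ) ^ 2 + ((δ : ℝ) - 1) * κ))) := by
      calc Q * D ≤ Q * (q : ℝ) ^ k * W +
            ((δ : ℝ) ^ 2 + ((δ : ℝ) - 1) * κ) * (q : ℝ) ^ k * (Q + (q : ℝ) ^ (k + 3)) := hkey
        _ ≤ Q * (q : ℝ) ^ k * W + ((δ : ℝ) ^ 2 + ((δ : ℝ) - 1) * κ) * (q : ℝ) ^ k * (Q + Q / 50) := by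
            linarith
        _ = Q * ((q : ℝ) ^ k * (W + 51 / 50 * ((δ : ℝ) ^ 2 + ((δ : ℝ) - 1) * κ))) := by ring
    exact le_of_mul_le_mul_left h1 hQ0
  -- the numerical inequality
  have hnum := numeric_le_five_mul_rpow hδ2 hδ8
  rw [show k + 1 - 1 = k from rfl]
  calc D ≤ (q : ℝ) ^ k * (W + 51 / 50 * ((δ : ℝ) ^ 2 + ((δ : ℝ) - 1) * κ)) := hD
    _ ≤ (q : ℝ) ^ k * (((δ - 1) * (δ - 2) : ℕ) * √(q : ℝ) + 5 * (δ : ℝ) ^ ((13 : ℝ) / 3)) := by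
        refine mul_le_mul_of_nonneg_left ?_ hqk
        rw [hW, hκ]
        linarith
    _ = ((δ - 1) * (δ - 2) : ℕ) * (q : ℝ) ^ k * √(q : ℝ) + 5 * (δ : ℝ) ^ ((13 : ℝ) / 3) * (q : ℝ) ^ k := by
        ring

end Main

/-! ### Theorem 5.2 for `δ ≤ 8` -/

/-- **Cafure–Matera (2006), Theorem 5.2, for absolutely irreducible hypersurfaces of degree
`δ ≤ 8`.** For a finite field `K = 𝔽_q`, `n ∈ ℕ`, and `f ∈ K[x₁, …, xₙ]` absolutely irreducible of
total degree `δ ≤ 8`: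
`|N(f) - q^{n-1}| ≤ (δ-1)(δ-2) q^{n-3/2} + 5δ^{13/3} q^{n-2}` (real powers, `N(f)` the number of
zeros in `Kⁿ`). The statement is that of the named fact `CafureMatera2006_thm52` restricted to
`δ ≤ 8`; see the module docstring for why the proof with Cor. 3.2 stops there.
[cite: CafureMatera2006, Thm. 5.2] -/
theorem CafureMatera2006_thm52_of_totalDegree_le_eight (K : Type) [Field K] [Fintype K]
    [DecidableEq K] (n : ℕ) (f : MvPolynomial (Fin n) K) (hf : IsAbsIrreducible f)
    (h8 : f.totalDegree ≤ 8) :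
    |(rationalPointCount f : ℝ) - (Fintype.card K : ℝ) ^ ((n : ℝ) - 1)| ≤
      ((f.totalDegree : ℝ) - 1) * ((f.totalDegree : ℝ) - 2) *
          (Fintype.card K : ℝ) ^ ((n : ℝ) - 3 / 2) +
        5 * (f.totalDegree : ℝ) ^ ((13 : ℝ) / 3) * (Fintype.card K : ℝ) ^ ((n : ℝ) - 2) := by
  set δ := f.totalDegree with hδ
  -- the elementary regimes
  by_cases hq : (Fintype.card K : ℝ) ≤ 5 * (δ : ℝ) ^ ((10 : ℝ) / 3)
  · exact CafureMatera2006_thm52_of_card_le hf hq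
  rw [not_le] at hq
  by_cases h1 : δ = 1
  · exact CafureMatera2006_thm52_of_totalDegree_eq_one h1
  have hδpos : 0 < δ := hf.totalDegree_pos
  have hδ2 : 2 ≤ δ := by omega
  -- `n ≥ 2`
  rcases n with _ | n
  · -- no variables: constants are not irreducible
    exfalso
    have : f.totalDegree = 0 := by
      rw [MvPolynomial.eq_C_of_isEmpty f, totalDegree_C]
    omega
  rcases n with _ | m
  · exfalso
    have := IsAbsIrreducible.totalDegree_eq_one_fin_one hf
    omega
  -- `n = m + 2`, i.e. `m + 1 ≥ 1` non-leading variables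
  have hmain := abs_rationalPointCount_sub_le_of_le_eight (K := K) (m := m + 1) (by omega) hf hδ2 h8
    rfl hq
  -- translate the powers
  set q : ℝ := (Fintype.card K : ℝ) with hq'
  have hq0 : 0 < q := by rw [hq']; exact_mod_cast Fintype.card_pos
  have e1 : q ^ (((m + 1 + 1 : ℕ) : ℝ) - 1) = q ^ (m + 1) := by
    rw [show (((m + 1 + 1 : ℕ) : ℝ) - 1) = ((m + 1 : ℕ) : ℝ) by push_cast; ring, Real.rpow_natCast]
  have e2 : q ^ (((m + 1 + 1 : ℕ) : ℝ) - 3 / 2) = q ^ m * √q := by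
    rw [show (((m + 1 + 1 : ℕ) : ℝ) - 3 / 2) = ((m : ℕ) : ℝ) + 1 / 2 by push_cast; ring,
      Real.rpow_add hq0, Real.rpow_natCast, Real.sqrt_eq_rpow]
  have e3 : q ^ (((m + 1 + 1 : ℕ) : ℝ) - 2) = q ^ m := by
    rw [show (((m + 1 + 1 : ℕ) : ℝ) - 2) = ((m : ℕ) : ℝ) by push_cast; ring, Real.rpow_natCast]
  rw [e1, e2, e3]
  rw [show m + 1 - 1 = m from rfl] at hmain
  have hcast : (((δ - 1) * (δ - 2) : ℕ) : ℝ) = ((δ : ℝ) - 1) * ((δ : ℝ) - 2) := by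
    have h1' : 1 ≤ δ := by omega
    have h2' : 2 ≤ δ := hδ2
    push_cast [Nat.cast_sub h1', Nat.cast_sub h2']
    ring
  rw [hcast] at hmain
  calc |(rationalPointCount f : ℝ) - q ^ (m + 1)|
      ≤ ((δ : ℝ) - 1) * ((δ : ℝ) - 2) * q ^ m * √q + 5 * (δ : ℝ) ^ ((13 : ℝ) / 3) * q ^ m := hmain
    _ = ((δ : ℝ) - 1) * ((δ : ℝ) - 2) * (q ^ m * √q) + 5 * (δ : ℝ) ^ ((13 : ℝ) / 3) * q ^ m := by ring

end Literature.NumberTheory.DiophantineGeometry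

end
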